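import Literature.NumberTheory.Automorphic.UnitaryRankTwoTorusLocalClassRamifiedHead          -- ★ p843443 FILE 2: `localClass_normalForm_ramified` (edge)
import Literature.NumberTheory.Automorphic.UnitaryRankTwoTorusLocalClassRamifiedModularHead   -- ★-to-be FILE 3b: `localClass_normalForm_ramified_modular` (vertex)
import Literature.NumberTheory.Automorphic.UnitaryRankTwoTorusLocalClassRamifiedSign          -- ★ p843557 FILE 5: `normalForm_bit_iff_of_eigenline{,_modular}` (sign law)
import HarnessLib

/-!
# [LabesseLanglands1979 §2 pp. 8–9; Rogawski1990 §4.9] road «R1-ram», brick R-3 FILE 7: THE SIGNED WINDOW CLASS — LEMMA U′ with the bit DETERMINED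
# (`e = 0 ⟺ (−1)^{(N+i)∕2+1}·c·u·θ` has square residue), edge and vertex; the directly consumable form for the (R5b-α) per-piece depth sum

Topic `NumberTheory/Automorphic`; namespace `Literature.NumberTheory.Automorphic`.  THEOREMS ONLY (no definition, no instance, no notation, no named fact, no `sorry`).
Cell `pub/hodgecm-mathlib` (D-0151), crux H413 = `stmt-HodgeConjecture-24833`, residue `RankOneUnstableTransferNonsplitCMERamified` of #159; architect A-p16 (g27) RULINGS
A-15 (b), A-17 (a) §4 (ii), A-19 ((R5b-α): A-p13 (g31) types the ramified one-place depth expansion per piece against these heads; memo ba95cded (2)–(3)).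
HONEST LABEL: HC_CM is proved only modulo the printed citations (the 2 remaining named inputs hLiu418, h413) until rung 0 closes; nothing printed is asserted here.

THE HEADS.  **`localClass_signedNormalForm_ramified`** (edge `K`, `J₀`): the hypotheses of ★ `localClass_normalForm_ramified` plus a vector `v` spanning the `a`-eigenline of `k`
with `θ := h(v,v)` a unit ⟹ `Odd i ∧ Even (N + i) ∧ ∀ S, S = (−1)^{(N+i)∕2+1}·c·((a−c)ϖ^{−N})·θ → ∃ κ ∈ U(J₀)(𝒪), ∃ e ≤ 1 with (e = 0 ↔ S̄ square), ∃ R ∈ M₂(𝒪),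
J₀κᴴJ₀·k·κ = c(1 + ϖ^i[[0,η^e],[0,0]]) + ϖ^m R`; **`localClass_signedNormalForm_ramified_modular`** (vertex `K♯`, `J♯`, `Even i`, `Even (N+i+1)`, `ϖθ♯` in place of `θ`).
So the window class at a fixed facet is a FUNCTION of `(c mod ϖ^m, i, S̄ mod squares)` and, through `S`, of the facet only via `(N+i)∕2` (memo (3)).

## References
* [LabesseLanglands1979] J.-P. Labesse, R. P. Langlands, *L-indistinguishability for SL(2)*, Canad. J. Math. 31 (1979): §2, Lemma 2.1, pp. 8–9.
* [Rogawski1990] J. D. Rogawski, *Automorphic Representations of Unitary Groups in Three Variables*, Ann. of Math. Stud. 123 (1990): §4.9 Lemma 4.9.3 p. 56.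
* [Jacobowitz1962] R. Jacobowitz, *Hermitian forms over local fields*, Amer. J. Math. 84 (1962): §8. [Serre1979] J.-P. Serre, *Local Fields* (1979): Ch. V §3.
-/

set_option autoImplicit false

noncomputable section

open scoped ValuativeRel Matrix MatrixGroups
open Matrix ValuativeRel

namespace Literature.NumberTheory.Automorphic

variable {F : Type*} [Field F] [ValuativeRel F]

section Signed

variable (σ : F →+* F) {ϖ : F} (hϖ : IsUniformizingElement ϖ) (hσϖ : σ ϖ = -ϖ)
  (σO : 𝒪[F] →+* 𝒪[F]) (hσO : ∀ x : 𝒪[F], ((σO x : 𝒪[F]) : F) = σ x) (hσσ : ∀ x, σO (σO x) = x)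

include hϖ in
/-- `|a − c| = |ϖ^N|` ⇒ `a − c = ϖ^N·u` with `u := (a − c)ϖ^{−N}` a unit. [cite: Serre1979, Ch. V §2] -/
private theorem sub_eq_pow_mul_unit {a c : F} {N : ℕ} (hN : valuation F (a - c) = valuation F (ϖ ^ N)) :
    a - c = ϖ ^ N * ((a - c) * (ϖ ^ N)⁻¹) ∧ valuation F ((a - c) * (ϖ ^ N)⁻¹) = 1 := by
  have hϖN0 : (ϖ : F) ^ N ≠ 0 := pow_ne_zero _ hϖ.ne_zero
  have hϖN1 : valuation F (ϖ ^ N) ≠ 0 := (Valuation.ne_zero_iff _).2 hϖN0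
  refine ⟨by rw [mul_comm, inv_mul_cancel_right₀ hϖN0], ?_⟩
  rw [map_mul, map_inv₀, hN, mul_inv_cancel₀ hϖN1]

include hϖ hσϖ hσO hσσ in
/-- **THE SIGNED WINDOW CLASS (edge ∕ self-dual lattice, `J₀`).**  Hypotheses of ★ `localClass_normalForm_ramified` plus a vector `v` spanning the `a`-eigenline of `k`
(`kz = az ⇒ z ∈ Fv`) with `θ := Σ_r σ(v_r)(J₀v)_r` a unit.  Then `i` is odd, `N + i` is even, and for `S ∈ 𝒪` with `S = (−1)^{(N+i)∕2+1}·c·((a−c)(ϖ^N)⁻¹)·θ`: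
`(J₀κᴴJ₀)·k·κ = c·(1 + ϖ^i·[[0, η^e],[0,0]]) + ϖ^m·R` for some `κ ∈ U(J₀)(𝒪)`, `R ∈ M₂(𝒪)` and the bit `e ≤ 1` with `e = 0 ⟺ S̄` is a square.
[cite: LabesseLanglands1979, §2 Lemma 2.1 pp. 8–9] [cite: Rogawski1990, §4.9 Lemma 4.9.3 p. 56] [cite: Jacobowitz1962, §8] [cite: Serre1979, Ch. V §3] -/
theorem localClass_signedNormalForm_ramified
    [IsAdicComplete (IsLocalRing.maximalIdeal 𝒪[F]) 𝒪[F]] [Finite (IsLocalRing.ResidueField 𝒪[F])]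
    (h2 : IsUnit (2 : 𝒪[F])) (hres : ∀ x : 𝒪[F], σO x - x ∈ IsLocalRing.maximalIdeal 𝒪[F])
    {η : 𝒪[F]} (hηu : IsUnit η) (hση : σO η = η) (hη : ¬ IsSquare (IsLocalRing.residue 𝒪[F] η))
    {k : Matrix (Fin 2) (Fin 2) F} (hkO : ∀ r s, k r s ∈ 𝒪[F]) (hkU : (k.map σ)ᵀ * !![0, 1; 1, 0] * k = !![0, 1; 1, 0])
    {a c : F} (ha : σ a * a = 1) (hc : σ c * c = 1) (ha1 : valuation F a = 1) (hc1 : valuation F c = 1)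
    (hac : (k - a • 1) * (k - c • 1) = 0)
    {N : ℕ} (hN : valuation F (a - c) = valuation F (ϖ ^ N))
    {i m : ℕ} (him : i < m) (hmN : m ≤ N)
    (hki : ∀ r s, ϖ ^ (-(i : ℤ)) * (k - c • 1) r s ∈ 𝒪[F]) (hki' : ¬ ∀ r s, ϖ ^ (-((i : ℤ) + 1)) * (k - c • 1) r s ∈ 𝒪[F])
    (v : Fin 2 → F) (hv : ∀ z : Fin 2 → F, k *ᵥ z = a • z → ∃ ξ : F, z = ξ • v)
    (hθ : valuation F ((fun r => σ (v r)) ⬝ᵥ (!![0, 1; 1, 0] *ᵥ v)) = 1) :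
    Odd i ∧ Even (N + i) ∧ ∀ S : 𝒪[F], (S : F) = (-1) ^ ((N + i) / 2 + 1) * c * ((a - c) * (ϖ ^ N)⁻¹) * ((fun r => σ (v r)) ⬝ᵥ (!![0, 1; 1, 0] *ᵥ v)) →
      ∃ κ : Matrix (Fin 2) (Fin 2) F, (∀ r s, κ r s ∈ 𝒪[F]) ∧ (κ.map σ)ᵀ * !![0, 1; 1, 0] * κ = !![0, 1; 1, 0] ∧
        ∃ e : ℕ, e ≤ 1 ∧ (e = 0 ↔ IsSquare (IsLocalRing.residue 𝒪[F] S)) ∧ ∃ R : Matrix (Fin 2) (Fin 2) F, (∀ r s, R r s ∈ 𝒪[F]) ∧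
          !![0, 1; 1, 0] * (κ.map σ)ᵀ * !![0, 1; 1, 0] * k * κ = c • (1 + ϖ ^ i • !![0, ((η : 𝒪[F]) : F) ^ e; 0, 0]) + ϖ ^ m • R := by
  obtain ⟨hodd, κ, hκO, hκU, e, he, R, hRO, hnf⟩ := localClass_normalForm_ramified σ hϖ hσϖ σO hσO hσσ h2 hres hηu hση hη hkO hkU ha hc ha1 hc1 hac hN
    him hmN hki hki'
  obtain ⟨hu, hu1⟩ := sub_eq_pow_mul_unit hϖ hN
  obtain ⟨hev, hsign⟩ := normalForm_bit_iff_of_eigenline σ hϖ hσϖ σO hσO hσσ hres hηu hση hη hκO hκU hRO ha hc hc1 hkU hac hu hu1 him hodd he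
    hnf v hv hθ
  exact ⟨hodd, hev, fun S hS => ⟨κ, hκO, hκU, e, he, (hsign S hS).symm, R, hRO, hnf⟩⟩

include hϖ hσϖ hσO hσσ in
/-- **THE SIGNED WINDOW CLASS (vertex ∕ `ϖ`-modular lattice, `J♯ = [[0,−1],[1,0]]`).**  Hypotheses of ★ `localClass_normalForm_ramified_modular` plus `v` spanning the
`a`-eigenline with `|ϖ·θ♯| = 1`, `θ♯ := Σ_r σ(v_r)(J♯v)_r`.  Then `i` is even, `N + i + 1` is even, and for `S = (−1)^{(N+i+1)∕2+1}·c·((a−c)(ϖ^N)⁻¹)·(ϖθ♯)` the normal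
form holds with the bit `e ≤ 1`, `e = 0 ⟺ S̄` is a square. [cite: LabesseLanglands1979, §2 Lemma 2.1 pp. 8–9] [cite: Rogawski1990, §4.9 Lemma 4.9.3 p. 56]
[cite: Jacobowitz1962, §8] [cite: Serre1979, Ch. V §3] -/
theorem localClass_signedNormalForm_ramified_modular
    [IsAdicComplete (IsLocalRing.maximalIdeal 𝒪[F]) 𝒪[F]] [Finite (IsLocalRing.ResidueField 𝒪[F])]
    (h2 : IsUnit (2 : 𝒪[F])) (hres : ∀ x : 𝒪[F], σO x - x ∈ IsLocalRing.maximalIdeal 𝒪[F])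
    {η : 𝒪[F]} (hηu : IsUnit η) (hση : σO η = η) (hη : ¬ IsSquare (IsLocalRing.residue 𝒪[F] η))
    {k : Matrix (Fin 2) (Fin 2) F} (hkO : ∀ r s, k r s ∈ 𝒪[F]) (hkU : (k.map σ)ᵀ * !![0, -1; 1, 0] * k = !![0, -1; 1, 0])
    {a c : F} (ha : σ a * a = 1) (hc : σ c * c = 1) (ha1 : valuation F a = 1) (hc1 : valuation F c = 1)
    (hac : (k - a • 1) * (k - c • 1) = 0)
    {N : ℕ} (hN : valuation F (a - c) = valuation F (ϖ ^ N))
    {i m : ℕ} (him : i < m) (hmN : m ≤ N)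
    (hki : ∀ r s, ϖ ^ (-(i : ℤ)) * (k - c • 1) r s ∈ 𝒪[F]) (hki' : ¬ ∀ r s, ϖ ^ (-((i : ℤ) + 1)) * (k - c • 1) r s ∈ 𝒪[F])
    (v : Fin 2 → F) (hv : ∀ z : Fin 2 → F, k *ᵥ z = a • z → ∃ ξ : F, z = ξ • v)
    (hθ : valuation F (ϖ * ((fun r => σ (v r)) ⬝ᵥ (!![0, -1; 1, 0] *ᵥ v))) = 1) :
    Even i ∧ Even (N + i + 1) ∧ ∀ S : 𝒪[F],
      (S : F) = (-1) ^ ((N + i + 1) / 2 + 1) * c * ((a - c) * (ϖ ^ N)⁻¹) * (ϖ * ((fun r => σ (v r)) ⬝ᵥ (!![0, -1; 1, 0] *ᵥ v))) →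
      ∃ κ : Matrix (Fin 2) (Fin 2) F, (∀ r s, κ r s ∈ 𝒪[F]) ∧ (κ.map σ)ᵀ * !![0, -1; 1, 0] * κ = !![0, -1; 1, 0] ∧
        ∃ e : ℕ, e ≤ 1 ∧ (e = 0 ↔ IsSquare (IsLocalRing.residue 𝒪[F] S)) ∧ ∃ R : Matrix (Fin 2) (Fin 2) F, (∀ r s, R r s ∈ 𝒪[F]) ∧
          !![0, 1; -1, 0] * (κ.map σ)ᵀ * !![0, -1; 1, 0] * k * κ = c • (1 + ϖ ^ i • !![0, ((η : 𝒪[F]) : F) ^ e; 0, 0]) + ϖ ^ m • R := by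
  obtain ⟨heven, κ, hκO, hκU, e, he, R, hRO, hnf⟩ := localClass_normalForm_ramified_modular σ hϖ hσϖ σO hσO hσσ h2 hres hηu hση hη hkO hkU ha hc ha1
    hc1 hac hN him hmN hki hki'
  obtain ⟨hu, hu1⟩ := sub_eq_pow_mul_unit hϖ hN
  obtain ⟨hev, hsign⟩ := normalForm_bit_iff_of_eigenline_modular σ hϖ hσϖ σO hσO hσσ hres hηu hση hη hκO hκU hRO ha hc hc1 hkU hac hu hu1 him
    heven he hnf v hv hθ
  exact ⟨heven, hev, fun S hS => ⟨κ, hκO, hκU, e, he, (hsign S hS).symm, R, hRO, hnf⟩⟩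

end Signed

end Literature.NumberTheory.Automorphic

end
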